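import Summits.MatrixMultiplication.MatrixMultiplication.Theorems.EdgePencilFlatSummandPrice
import Summits.MatrixMultiplication.MatrixMultiplication.Theorems.EdgePencilReroutingCover
import Literature.Computability.AlgebraicComplexity.DTensorGaugePoints
import HarnessLib

/-!
# Gauge points on the sixth-edge family: the values `ζ^{(0)}` and `ζ^{(02)}` of `W_n^{(e)}` and `D_n`

Support kernel for `stmt-MatrixMultiplication-26697` (`TetraExcessZero : ω(K₄) ≤ ω(2,1,2)`, the attacked
leaf of route `TetrahedronCarving`; cut of record `closes (TetraExcessZero) (TetraPlusTwo) : ω = 2`,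
UNCHANGED; lineage `decomp-mm-lens-6` «barrier-complement carving», generation 43; the companion file
`EdgePencilFlatSummandGaugeLaws` reads the flat-summand purchase at these points). No item is added or
changed; no definition is introduced. NOTATION as in `EdgePencilFlatSummand`: `W_n^{(e)} = sixTetra F n e`
(the `K₄` graph tensor with bond `e` on the edge `01`, bond `n` elsewhere; leg index = label triple, vertex
`0` sees `(ℓ₀₁, ℓ₀₂, ℓ₀₃)`, vertex `1` sees `(ℓ₀₁, ℓ₁₂, ℓ₁₃)`, vertex `2` sees `(ℓ₀₂, ℓ₁₂, ℓ₂₃)`, vertex `3`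
sees `(ℓ₀₃, ℓ₁₃, ℓ₂₃)`), `D_n = W_n^{(1)}` the diamond, `T₄(F) = DTensorClass F 4` the semiring of 4-tensors
modulo restriction, `[t] = DTensorClass.mk t`.

THE OBJECT. The tree holds exactly one family of genuine 4-party spectral points: the GAUGE POINTS
`ζ^{(S)}` = flattening rank along a bipartition `S ⊔ Sᶜ` of the four legs (Literature `DTensorGaugePoints`:
`DTensor.flatS`, `DTensorClass.gaugeRank`, additive, multiplicative, `≤`-monotone, normalised, hence
`gaugeRank_mem_asymptoticSpectrumDTensors`). This file EVALUATES two of them on the sixth-edge family by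
explicit linear algebra (an identity minor for the lower bounds, a factorisation through few rows for the
upper bounds):

* §1 `enc_lab`, `lab_enc_fst/snd/thd` (labels of encoded triples); the pointwise value of `W_n^{(e)}`
  (indicator of: `ℓ₀₁ < e` at vertex `0` and the six edge consistencies) is the tree's
  `EdgePencilReroutingCover.sixTetra_apply`.
* §2 THE PARTY-`0` POINT `ζ^{(0)}` (`S = {0}`, cut edges `01, 02, 03`): `e·n² ≤ rank flat_{0}(W_n^{(e)})`
  (`e ≤ n`; the rows `(ℓ₀₁, ℓ₀₂, ℓ₀₃)`, `ℓ₀₁ < e`, against the columns "all other labels `0`" give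
  `P · flat · Q = 1` of size `e n²`) and `rank flat_{0}(D_n) ≤ n²` (`flat = A · B` through the `n²` rows
  with `ℓ₀₁ = 0`; every other row vanishes).
* §3 THE PAIR POINT `ζ^{(02)}` (`S = {0,2}`, cut edges `01, 03, 12, 23`, internal edges `02 | 13`):
  `e·n³ ≤ rank flat_{02}(W_n^{(e)})` and `rank flat_{02}(D_n) ≤ n³` (a nonzero row has `ℓ₀₁ = 0`, agrees
  with itself on the internal edge, and depends only on its three cut labels).
* §4 The same four bounds on the classes `[W_n^{(e)}], [D_n] ∈ T₄(F)` (`gaugeRank_mk`):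
  `mul_sq_le_gaugeRank_zero_sixTetra`, `gaugeRank_zero_diamond_le`, `mul_cube_le_gaugeRank_pair_sixTetra`,
  `gaugeRank_pair_diamond_le`.

(The exact values are `ζ^{(0)}(W_n^{(e)}) = e n²`, `ζ^{(02)}(W_n^{(e)}) = e n³` — product of the cut bonds,
CVZ16 §1.2 eq. (flat); only the displayed inequalities are proved and used.)

References: Christandl–Vrana–Zuiddam 2023, Example 1.4 (gauge points are spectral points), Thm. 1.1
[ChristandlVranaZuiddam2023]; Christandl–Vrana–Zuiddam, arXiv:1609.07476, Ex. 1.1.2, §1.2 eq. (flat)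
(flattening ranks of graph tensors along a cut) [ChristandlVranaZuiddam2016]; Zuiddam 2018, Def. 2.8
[Zuiddam2018].
No `sorry`, no new axiom, no instance, no notation, no definition.
-/

noncomputable section

set_option linter.dupNamespace false

open Finset Literature.Computability.AlgebraicComplexity
open Summit.MatrixMultiplication.MatrixMultiplication.Theorems.TetrahedronTensor
open Summit.MatrixMultiplication.MatrixMultiplication.Theorems.TetraDiagonal
open Summit.MatrixMultiplication.MatrixMultiplication.Theses.TetrahedronCarving

namespace Summit.MatrixMultiplication.MatrixMultiplication.Theorems.EdgePencil

/-! ## §1 Labels of encoded triples -/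

section Pointwise

variable {F : Type*} [Field F]

/-- The labels of an encoded label triple, slot `0`. -/
theorem lab_enc_fst {n : ℕ} (x y z : Fin n) : lab (enc x y z) 0 = x := by
  simp [lab, symm_enc]

/-- The labels of an encoded label triple, slot `1`. -/
theorem lab_enc_snd {n : ℕ} (x y z : Fin n) : lab (enc x y z) 1 = y := by
  simp [lab, symm_enc]

/-- The labels of an encoded label triple, slot `2`. -/
theorem lab_enc_thd {n : ℕ} (x y z : Fin n) : lab (enc x y z) 2 = z := by
  simp [lab, symm_enc]

/-- A leg index is the encoding of its three labels. -/
theorem enc_lab {n : ℕ} (x : Fin (n ^ 3)) : enc (lab x 0) (lab x 1) (lab x 2) = x := by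
  have h : (![lab x 0, lab x 1, lab x 2] : Fin 3 → Fin n) = finFunctionFinEquiv.symm x := by
    funext j
    fin_cases j <;> rfl
  rw [enc, h, Equiv.apply_symm_apply]

end Pointwise

/-! ## §2 The party-`0` gauge point `ζ^{(0)}` on the family -/

section PartyZero

variable {F : Type*} [Field F]

/-- **`e·n² ≤ ζ^{(0)}(W_n^{(e)})`** (`e ≤ n`): the `e n²` rows `(ℓ₀₁, ℓ₀₂, ℓ₀₃)`, `ℓ₀₁ < e`, of the
party-`0` flattening against the columns "every other label `0`" form an identity minor.
[cite: ChristandlVranaZuiddam2016, §1.2 eq. (flat)] -/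
theorem mul_sq_le_rank_flatS_zero_sixTetra {n e : ℕ} (hn : 1 ≤ n) (he : e ≤ n) :
    e * n ^ 2 ≤ (DTensor.flatS (fun j : Fin 4 => j = 0) (sixTetra F n e)).rank := by
  classical
  haveI : NeZero n := NeZero.of_pos hn
  set M := DTensor.flatS (fun j : Fin 4 => j = 0) (sixTetra F n e) with hM
  set ρ : Fin e × Fin n × Fin n → ({j : Fin 4 // j = 0} → Fin (n ^ 3)) :=
    fun q _ => enc (Fin.castLE he q.1) q.2.1 q.2.2 with hρ
  set κ : Fin e × Fin n × Fin n → ({j : Fin 4 // ¬ j = 0} → Fin (n ^ 3)) :=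
    fun q j => if (j : Fin 4) = 1 then enc (Fin.castLE he q.1) 0 0
      else if (j : Fin 4) = 2 then enc q.2.1 0 0 else enc q.2.2 0 0 with hκ
  set P : Matrix (Fin e × Fin n × Fin n) ({j : Fin 4 // j = 0} → Fin (n ^ 3)) F :=
    Matrix.of fun q r => if r = ρ q then (1 : F) else 0 with hP
  set Q : Matrix ({j : Fin 4 // ¬ j = 0} → Fin (n ^ 3)) (Fin e × Fin n × Fin n) F :=
    Matrix.of fun c q => if c = κ q then (1 : F) else 0 with hQ
  have hval : ∀ q q' : Fin e × Fin n × Fin n, M (ρ q) (κ q') = if q = q' then 1 else 0 := by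
    rintro ⟨j, a, b⟩ ⟨j', a', b'⟩
    have e0 : DTensor.merge (fun j : Fin 4 => j = 0) (ρ (j, a, b)) (κ (j', a', b')) 0 =
        enc (Fin.castLE he j) a b := by simp [DTensor.merge, hρ]
    have e1 : DTensor.merge (fun j : Fin 4 => j = 0) (ρ (j, a, b)) (κ (j', a', b')) 1 =
        enc (Fin.castLE he j') 0 0 := by simp [DTensor.merge, hκ]
    have e2 : DTensor.merge (fun j : Fin 4 => j = 0) (ρ (j, a, b)) (κ (j', a', b')) 2 =
        enc a' 0 0 := by simp [DTensor.merge, hκ]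
    have e3 : DTensor.merge (fun j : Fin 4 => j = 0) (ρ (j, a, b)) (κ (j', a', b')) 3 =
        enc b' 0 0 := by simp [DTensor.merge, hκ]
    rw [hM, DTensor.flatS_apply_apply, sixTetra_apply, e0, e1, e2, e3]
    simp only [lab_enc_fst, lab_enc_snd, lab_enc_thd, Fin.val_castLE, Fin.is_lt, true_and, and_true,
      Prod.mk.injEq, (Fin.castLE_injective he).eq_iff]
    by_cases hj : j = j' <;> by_cases ha : a = a' <;> by_cases hb : b = b' <;> simp [ind, hj, ha, hb]
  have hPMQ : P * M * Q = 1 := by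
    ext q q'
    simp only [Matrix.mul_apply, hP, hQ, Matrix.of_apply, ite_mul, one_mul, zero_mul, mul_ite, mul_one,
      mul_zero, Finset.sum_ite_eq', Finset.mem_univ, if_true, Matrix.one_apply]
    exact hval q q'
  have hcard : Fintype.card (Fin e × Fin n × Fin n) = e * n ^ 2 := by
    simp only [Fintype.card_prod, Fintype.card_fin]
    ring
  calc e * n ^ 2 = (P * M * Q).rank := by rw [hPMQ, Matrix.rank_one, hcard]
    _ ≤ (P * M).rank := Matrix.rank_mul_le_left _ _
    _ ≤ M.rank := Matrix.rank_mul_le_right _ _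

/-- **`ζ^{(0)}(D_n) ≤ n²`**: the party-`0` flattening of the diamond factors through its `n²` rows with
`ℓ₀₁ = 0` (all other rows vanish). [cite: ChristandlVranaZuiddam2016, §1.2 eq. (flat)] -/
theorem rank_flatS_zero_diamond_le {n : ℕ} (hn : 1 ≤ n) :
    (DTensor.flatS (fun j : Fin 4 => j = 0) (sixTetra F n 1)).rank ≤ n ^ 2 := by
  classical
  haveI : NeZero n := NeZero.of_pos hn
  set M := DTensor.flatS (fun j : Fin 4 => j = 0) (sixTetra F n 1) with hM
  set ρ : Fin n × Fin n → ({j : Fin 4 // j = 0} → Fin (n ^ 3)) := fun q _ => enc 0 q.1 q.2 with hρ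
  set A : Matrix ({j : Fin 4 // j = 0} → Fin (n ^ 3)) (Fin n × Fin n) F :=
    Matrix.of fun r q => if r = ρ q then (1 : F) else 0 with hA
  set B : Matrix (Fin n × Fin n) ({j : Fin 4 // ¬ j = 0} → Fin (n ^ 3)) F :=
    Matrix.of fun q c => M (ρ q) c with hB
  have hρinj : ∀ q q' : Fin n × Fin n, ρ q = ρ q' ↔ q = q' := by
    rintro ⟨a, b⟩ ⟨a', b'⟩
    refine ⟨fun h => ?_, fun h => by rw [h]⟩
    have h' : enc (0 : Fin n) a b = enc 0 a' b' := congrFun h ⟨0, rfl⟩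
    have ha : a = a' := by simpa [lab_enc_snd] using congrArg (fun x => lab x 1) h'
    have hb : b = b' := by simpa [lab_enc_thd] using congrArg (fun x => lab x 2) h'
    rw [ha, hb]
  have hAB : A * B = M := by
    ext r c
    simp only [Matrix.mul_apply, hA, hB, Matrix.of_apply, ite_mul, one_mul, zero_mul]
    -- the row `r` is determined by its value `x` at the unique leg `0`
    have hr : r = fun _ => r ⟨0, rfl⟩ := by
      funext j
      obtain ⟨j, hj⟩ := j
      subst hj
      rfl
    by_cases h0 : lab (r ⟨0, rfl⟩) 0 = 0
    · -- `r = ρ (ℓ₀₂, ℓ₀₃)`: exactly one term survives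
      obtain ⟨q₀, hq₀⟩ : ∃ q₀ : Fin n × Fin n, q₀ = (lab (r ⟨0, rfl⟩) 1, lab (r ⟨0, rfl⟩) 2) :=
        ⟨_, rfl⟩
      have hrρ : r = ρ q₀ := by
        rw [hr, hq₀]
        funext j
        simp only [hρ]
        rw [← h0, enc_lab]
      have hsum : ∀ q : Fin n × Fin n, (if r = ρ q then M (ρ q) c else 0) =
          if q = q₀ then M (ρ q) c else 0 := by
        intro q
        by_cases hq : q = q₀
        · rw [if_pos hq, if_pos (hrρ.trans (by rw [hq]))]
        · rw [if_neg hq, if_neg]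
          intro h
          exact hq (((hρinj q₀ q).1 (hrρ.symm.trans h)).symm)
      rw [Finset.sum_congr rfl fun q _ => hsum q, Finset.sum_ite_eq', if_pos (Finset.mem_univ _), ← hrρ]
    · -- no term survives, and the row vanishes (`ℓ₀₁ ≠ 0`, bond `1`)
      have hsum : ∀ q : Fin n × Fin n, (if r = ρ q then M (ρ q) c else 0) = 0 := by
        intro q
        rw [if_neg]
        intro hq
        apply h0
        rw [hq]
        simp [hρ]
      rw [Finset.sum_congr rfl fun q _ => hsum q, Finset.sum_const_zero, hM, DTensor.flatS_apply_apply,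
        sixTetra_apply]
      have hm : DTensor.merge (fun j : Fin 4 => j = 0) r c 0 = r ⟨0, rfl⟩ := by simp [DTensor.merge]
      rw [hm, ind, if_neg]
      rintro ⟨hlt, -⟩
      exact h0 (Fin.ext (by simpa using hlt))
  calc M.rank = (A * B).rank := by rw [hAB]
    _ ≤ B.rank := Matrix.rank_mul_le_right _ _
    _ ≤ Fintype.card (Fin n × Fin n) := Matrix.rank_le_card_height _
    _ = n ^ 2 := by simp only [Fintype.card_prod, Fintype.card_fin]; ring

end PartyZero

/-! ## §3 The pair gauge point `ζ^{(02)}` on the family -/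

section Pair

variable {F : Type*} [Field F]

/-- **`e·n³ ≤ ζ^{(02)}(W_n^{(e)})`** (`e ≤ n`; the cut `{0,2} ⊔ {1,3}` crosses the edges `01, 03, 12,
23` of bonds `e, n, n, n`): the rows `((ℓ₀₁, 0, ℓ₀₃), (0, ℓ₁₂, ℓ₂₃))` against the columns
`((ℓ₀₁, ℓ₁₂, 0), (ℓ₀₃, 0, ℓ₂₃))` form an identity minor of size `e n³`.
[cite: ChristandlVranaZuiddam2016, §1.2 eq. (flat)] -/
theorem mul_cube_le_rank_flatS_pair_sixTetra {n e : ℕ} (hn : 1 ≤ n) (he : e ≤ n) :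
    e * n ^ 3 ≤ (DTensor.flatS (fun j : Fin 4 => j = 0 ∨ j = 2) (sixTetra F n e)).rank := by
  classical
  haveI : NeZero n := NeZero.of_pos hn
  set M := DTensor.flatS (fun j : Fin 4 => j = 0 ∨ j = 2) (sixTetra F n e) with hM
  set ρ : Fin e × Fin n × Fin n × Fin n → ({j : Fin 4 // j = 0 ∨ j = 2} → Fin (n ^ 3)) :=
    fun q j => if (j : Fin 4) = 0 then enc (Fin.castLE he q.1) 0 q.2.1 else enc 0 q.2.2.1 q.2.2.2
    with hρ
  set κ : Fin e × Fin n × Fin n × Fin n → ({j : Fin 4 // ¬ (j = 0 ∨ j = 2)} → Fin (n ^ 3)) :=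
    fun q j => if (j : Fin 4) = 1 then enc (Fin.castLE he q.1) q.2.2.1 0 else enc q.2.1 0 q.2.2.2
    with hκ
  set P : Matrix (Fin e × Fin n × Fin n × Fin n) ({j : Fin 4 // j = 0 ∨ j = 2} → Fin (n ^ 3)) F :=
    Matrix.of fun q r => if r = ρ q then (1 : F) else 0 with hP
  set Q : Matrix ({j : Fin 4 // ¬ (j = 0 ∨ j = 2)} → Fin (n ^ 3)) (Fin e × Fin n × Fin n × Fin n) F :=
    Matrix.of fun c q => if c = κ q then (1 : F) else 0 with hQ
  have hval : ∀ q q' : Fin e × Fin n × Fin n × Fin n,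
      M (ρ q) (κ q') = if q = q' then 1 else 0 := by
    rintro ⟨j, b, c, d⟩ ⟨j', b', c', d'⟩
    have e0 : DTensor.merge (fun j : Fin 4 => j = 0 ∨ j = 2) (ρ (j, b, c, d)) (κ (j', b', c', d')) 0 =
        enc (Fin.castLE he j) 0 b := by simp [DTensor.merge, hρ]
    have e1 : DTensor.merge (fun j : Fin 4 => j = 0 ∨ j = 2) (ρ (j, b, c, d)) (κ (j', b', c', d')) 1 =
        enc (Fin.castLE he j') c' 0 := by simp [DTensor.merge, hκ]
    have e2 : DTensor.merge (fun j : Fin 4 => j = 0 ∨ j = 2) (ρ (j, b, c, d)) (κ (j', b', c', d')) 2 =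
        enc 0 c d := by simp [DTensor.merge, hρ]
    have e3 : DTensor.merge (fun j : Fin 4 => j = 0 ∨ j = 2) (ρ (j, b, c, d)) (κ (j', b', c', d')) 3 =
        enc b' 0 d' := by simp [DTensor.merge, hκ]
    rw [hM, DTensor.flatS_apply_apply, sixTetra_apply, e0, e1, e2, e3]
    simp only [lab_enc_fst, lab_enc_snd, lab_enc_thd, Fin.val_castLE, Fin.is_lt, true_and,
      Prod.mk.injEq, (Fin.castLE_injective he).eq_iff]
    by_cases hj : j = j' <;> by_cases hb : b = b' <;> by_cases hc : c = c' <;> by_cases hd : d = d' <;>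
      simp [ind, hj, hb, hc, hd, eq_comm]
  have hPMQ : P * M * Q = 1 := by
    ext q q'
    simp only [Matrix.mul_apply, hP, hQ, Matrix.of_apply, ite_mul, one_mul, zero_mul, mul_ite, mul_one,
      mul_zero, Finset.sum_ite_eq', Finset.mem_univ, if_true, Matrix.one_apply]
    exact hval q q'
  have hcard : Fintype.card (Fin e × Fin n × Fin n × Fin n) = e * n ^ 3 := by
    simp only [Fintype.card_prod, Fintype.card_fin]
    ring
  calc e * n ^ 3 = (P * M * Q).rank := by rw [hPMQ, Matrix.rank_one, hcard]
    _ ≤ (P * M).rank := Matrix.rank_mul_le_left _ _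
    _ ≤ M.rank := Matrix.rank_mul_le_right _ _

/-- **`ζ^{(02)}(D_n) ≤ n³`**: the `{0,2}`-flattening of the diamond factors through the `n³` rows
`((0, 0, ℓ₀₃), (0, ℓ₁₂, ℓ₂₃))` (a nonzero row has `ℓ₀₁ = 0`, agrees with itself on the internal edge `02`,
and depends only on its cut labels `ℓ₀₃, ℓ₁₂, ℓ₂₃`). [cite: ChristandlVranaZuiddam2016, §1.2 eq. (flat)] -/
theorem rank_flatS_pair_diamond_le {n : ℕ} (hn : 1 ≤ n) :
    (DTensor.flatS (fun j : Fin 4 => j = 0 ∨ j = 2) (sixTetra F n 1)).rank ≤ n ^ 3 := by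
  classical
  haveI : NeZero n := NeZero.of_pos hn
  set M := DTensor.flatS (fun j : Fin 4 => j = 0 ∨ j = 2) (sixTetra F n 1) with hM
  set ρ : Fin n × Fin n × Fin n → ({j : Fin 4 // j = 0 ∨ j = 2} → Fin (n ^ 3)) :=
    fun q j => if (j : Fin 4) = 0 then enc 0 0 q.1 else enc 0 q.2.1 q.2.2 with hρ
  -- the two legs of a row index
  have h0mem : (0 : Fin 4) = 0 ∨ (0 : Fin 4) = 2 := Or.inl rfl
  have h2mem : (2 : Fin 4) = 0 ∨ (2 : Fin 4) = 2 := Or.inr rfl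
  set A : Matrix ({j : Fin 4 // j = 0 ∨ j = 2} → Fin (n ^ 3)) (Fin n × Fin n × Fin n) F :=
    Matrix.of fun r q =>
      if lab (r ⟨0, h0mem⟩) 0 = 0 ∧ lab (r ⟨0, h0mem⟩) 1 = lab (r ⟨2, h2mem⟩) 0 then
        (if q = (lab (r ⟨0, h0mem⟩) 2, lab (r ⟨2, h2mem⟩) 1, lab (r ⟨2, h2mem⟩) 2) then (1 : F) else 0)
      else 0 with hA
  set B : Matrix (Fin n × Fin n × Fin n) ({j : Fin 4 // ¬ (j = 0 ∨ j = 2)} → Fin (n ^ 3)) F :=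
    Matrix.of fun q c => M (ρ q) c with hB
  have hAB : A * B = M := by
    ext r c
    -- evaluate both flattening entries pointwise
    have m0 : DTensor.merge (fun j : Fin 4 => j = 0 ∨ j = 2) r c 0 = r ⟨0, h0mem⟩ := by
      simp [DTensor.merge]
    have m2 : DTensor.merge (fun j : Fin 4 => j = 0 ∨ j = 2) r c 2 = r ⟨2, h2mem⟩ := by
      simp [DTensor.merge]
    have m1 : ∀ s : {j : Fin 4 // j = 0 ∨ j = 2} → Fin (n ^ 3),
        DTensor.merge (fun j : Fin 4 => j = 0 ∨ j = 2) s c 1 = c ⟨1, by decide⟩ := by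
      intro s; simp [DTensor.merge]
    have m3 : ∀ s : {j : Fin 4 // j = 0 ∨ j = 2} → Fin (n ^ 3),
        DTensor.merge (fun j : Fin 4 => j = 0 ∨ j = 2) s c 3 = c ⟨3, by decide⟩ := by
      intro s; simp [DTensor.merge]
    have mρ0 : ∀ q : Fin n × Fin n × Fin n,
        DTensor.merge (fun j : Fin 4 => j = 0 ∨ j = 2) (ρ q) c 0 = enc 0 0 q.1 := by
      intro q; simp [DTensor.merge, hρ]
    have mρ2 : ∀ q : Fin n × Fin n × Fin n,
        DTensor.merge (fun j : Fin 4 => j = 0 ∨ j = 2) (ρ q) c 2 = enc 0 q.2.1 q.2.2 := by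
      intro q; simp [DTensor.merge, hρ]
    simp only [Matrix.mul_apply, hA, hB, Matrix.of_apply]
    by_cases hcond : lab (r ⟨0, h0mem⟩) 0 = 0 ∧ lab (r ⟨0, h0mem⟩) 1 = lab (r ⟨2, h2mem⟩) 0
    · simp only [if_pos hcond, ite_mul, one_mul, zero_mul, Finset.sum_ite_eq', Finset.mem_univ, if_true]
      obtain ⟨h0, h02⟩ := hcond
      rw [hM, DTensor.flatS_apply_apply, DTensor.flatS_apply_apply, sixTetra_apply, sixTetra_apply,
        mρ0, mρ2, m1, m3, m0, m2, m1, m3]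
      simp only [lab_enc_fst, lab_enc_snd, lab_enc_thd, h0, h02, Fin.val_zero, Nat.zero_lt_one,
        true_and]
    · simp only [if_neg hcond, zero_mul, Finset.sum_const_zero]
      rw [hM, DTensor.flatS_apply_apply, sixTetra_apply, m0, m2, m1, m3, ind, eq_comm, if_neg]
      rintro ⟨hlt, h01, h02, -⟩
      apply hcond
      refine ⟨Fin.ext ?_, h02⟩
      simpa using hlt
  calc M.rank = (A * B).rank := by rw [hAB]
    _ ≤ B.rank := Matrix.rank_mul_le_right _ _
    _ ≤ Fintype.card (Fin n × Fin n × Fin n) := Matrix.rank_le_card_height _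
    _ = n ^ 3 := by simp only [Fintype.card_prod, Fintype.card_fin]; ring

end Pair

/-! ## §4 The four values on the classes `[W_n^{(e)}], [D_n] ∈ T₄(F)` -/

section Classes

variable {F : Type*} [Field F]

/-- `e·n² ≤ ζ^{(0)}[W_n^{(e)}]` in `T₄(F)`. [cite: ChristandlVranaZuiddam2023, Example 1.4] -/
theorem mul_sq_le_gaugeRank_zero_sixTetra {n e : ℕ} (hn : 1 ≤ n) (he : e ≤ n) :
    e * n ^ 2 ≤ DTensorClass.gaugeRank (fun j : Fin 4 => j = 0) (DTensorClass.mk (sixTetra F n e)) := by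
  rw [DTensorClass.gaugeRank_mk]
  exact mul_sq_le_rank_flatS_zero_sixTetra hn he

/-- `ζ^{(0)}[D_n] ≤ n²` in `T₄(F)`. [cite: ChristandlVranaZuiddam2023, Example 1.4] -/
theorem gaugeRank_zero_diamond_le {n : ℕ} (hn : 1 ≤ n) :
    DTensorClass.gaugeRank (fun j : Fin 4 => j = 0) (DTensorClass.mk (sixTetra F n 1)) ≤ n ^ 2 := by
  rw [DTensorClass.gaugeRank_mk]
  exact rank_flatS_zero_diamond_le hn

/-- `e·n³ ≤ ζ^{(02)}[W_n^{(e)}]` in `T₄(F)`. [cite: ChristandlVranaZuiddam2023, Example 1.4] -/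
theorem mul_cube_le_gaugeRank_pair_sixTetra {n e : ℕ} (hn : 1 ≤ n) (he : e ≤ n) :
    e * n ^ 3 ≤
      DTensorClass.gaugeRank (fun j : Fin 4 => j = 0 ∨ j = 2) (DTensorClass.mk (sixTetra F n e)) := by
  rw [DTensorClass.gaugeRank_mk]
  exact mul_cube_le_rank_flatS_pair_sixTetra hn he

/-- `ζ^{(02)}[D_n] ≤ n³` in `T₄(F)`. [cite: ChristandlVranaZuiddam2023, Example 1.4] -/
theorem gaugeRank_pair_diamond_le {n : ℕ} (hn : 1 ≤ n) :
    DTensorClass.gaugeRank (fun j : Fin 4 => j = 0 ∨ j = 2) (DTensorClass.mk (sixTetra F n 1)) ≤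
      n ^ 3 := by
  rw [DTensorClass.gaugeRank_mk]
  exact rank_flatS_pair_diamond_le hn

end Classes

end Summit.MatrixMultiplication.MatrixMultiplication.Theorems.EdgePencil

end
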